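import Summits.CriticalPhenomena.Ising3DConformalLimit.Theses.CoerciveSharpness
import Summits.CriticalPhenomena.Ising3DConformalLimit.Theorems.CoerciveSharpnessWindowOfGrowth
import Summits.CriticalPhenomena.Ising3DConformalLimit.Theorems.LatticeSDPCertificatesWindowBelowHalf
import Summits.CriticalPhenomena.Ising3DConformalLimit.Theorems.WindowOfGrowth.Negative.ProfileGrowthNoWindow
import Literature.Barriers.CriticalPhenomena.AxisProfileAxiomaticsNoDoubling
import Literature.Probability.LatticeModels.CriticalTwoPointDCPLowerHolds
import Literature.Probability.LatticeModels.IsingExponentsProofs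
import HarnessLib

/-!
# Disproof of `WindowOfGrowth` — findings (crux stmt-CriticalPhenomena-18198, route `CoerciveSharpness`, rank 4)

Standing crux disprover `cdisprove-stmt-CriticalPhenomena-18198`, cycle 1 (2026-08-17). The crux is
`WindowOfGrowth := Growth → (∃ η, HasIsingEtaBounds 3 η) → Window` with
* `Growth` = `∃ κ' c₀ > 0, ∃ N₀, ∀ n ≥ N₀, c₀ n^{κ'} ≤ Q(n)`, `Q` the route's WRITTEN-OUT reflected gradient of
  Duminil-Copin–Panis (arXiv:2404.05700, Thm 1.2) at `β_c(3)` (free state; `R_n x = update x 0 (2n - x₀)`);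
* `HasIsingEtaBounds 3 η` = two-sided pure-power bounds `c‖x‖^{-(1+η)} ≤ ⟨σ₀σ_x⟩⁺_{β_c(3)} ≤ C‖x‖^{-(1+η)}`;
* `Window` = `∃ ε c > 0, ∀ 1 ≤ m ≤ n, c (n/m)^{-(3/2-ε)} G(m e₁) ≤ G(n e₁)` (= item 5507 `WindowBelowHalf`).

## Findings (everything below is kernel-checked unless marked)

0. **NO DISPROOF EXISTS — the crux is a THEOREM** (`windowOfGrowth_holds`, `not_not_windowOfGrowth`): the line
   `eta_deficit` landed (stubs p157805 `stub_denominator_le`, p157830 `stub_reflGrad_le_majorant`, closing file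
   p157968 `Theorems.windowOfGrowth_proof`). Mechanism: DC–Panis Thm 1.3 majorant domination pointwise in the scale
   gives `c₀ n^{κ'} ≤ Q(4n) ≤ 5838·C(1+872C)·n^{1-2b}`, `b = min η 3/4`, so `κ' + 2η ≤ 1`, `η < 1/2`, and the
   tree's `windowBelowHalf_of_hasIsingEtaBounds` gives the window.
1. **Logical position** (`windowOfGrowth_iff_not_half`, `not_windowOfGrowth_iff`): relative to tree theorems,
   `WindowOfGrowth ↔ (Growth → ¬ HasIsingEtaBounds 3 (1/2))` and `¬WindowOfGrowth ↔ Growth ∧ HasIsingEtaBounds 3 (1/2)`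
   — a refutation would have had to PROVE `G ≍ ‖x‖^{-3/2}` on `ℤ³` together with polynomial growth of `Q`,
   which item 0 now shows contradictory.
2. **Load-bearing hypotheses.**
   (a) Drop `Growth`: `WindowOfGrowthWithoutGrowth ↔ ¬ HasIsingEtaBounds 3 (1/2)` (`withoutGrowth_iff`) — exactly the
       OPEN boundary case "`η ≠ 1/2` on `ℤ³`" (DC–Panis Thm 1.5 gives only `η ≤ 1/2`; bootstrap `η ≈ 0.036`): neither
       provable nor refutable in the tree; `Growth` is what excludes it (any proof must use `Growth`).
   (b) Drop `∃ η, HasIsingEtaBounds 3 η`: `WindowOfGrowthWithoutEtaBounds = Growth → Window` is implied by `Window`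
       (`withoutEtaBounds_of_window`), physically TRUE, hence not refutable at the concrete level; but at the
       PROFILE level it is FALSE (`windowOfGrowth_profile_false_without_etaBounds`, landed as
       `Theorems/WindowOfGrowth/Negative/ProfileGrowthNoWindow.lean`, p158487): the barrier witness
       `AxisProfileNoDoubling.g` has every axis-profile fact, the Källén–Lehmann shape, `n⁴ g³ ≥ 2⁻¹⁸/216`
       (`g ≥ c n^{-4/3}`) and PROFILE GROWTH with `κ' = 1/3` at every scale, yet no doubling, so no window; and
       `Growth ⇒` profile growth of the true axis profile (`profileGrowth_of_reflectedGradientGrowth`, via the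
       landed stub p157830). So the two-sided bounds (route item `DimensionPinned`, an open problem) cannot be
       replaced by any profile-level input (upper envelope, log-convexity, sliding-scale bound, DCP profile bound).
3. **Tightness** (remark, not formalised): on pure powers `g(n) = n^{-(1+η)}` the profile functional
   `g(n)(1 + Σ_{k≤4n} k² g + n Σ_{k≤2n} k g) ≍ n^{1-2η}`, so the deficit `κ' + 2η ≤ 1` extracted by the line is
   sharp and `ε = 1/2 - η ≥ κ'/2` cannot be improved by this mechanism; the witness of 2(b) sits exactly on it
   (growth exponent `< 1/2 = 1 - 2·(1/4)`, log-sense profile exponent `η = 1/4`).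
4. **Natural strengthenings.** (i) "profile facts + growth ⇒ window" — REFUTED (2b). (ii) "two-sided bounds ⇒ window"
   without growth — open (2a). (iii) conclusion with `ε` independent of the hypotheses is not at stake (`∃ ε`).
5. **Targets**: none (payload `stuck_stubs = []`; both registered stubs landed before this seat started).

WHY IT RESISTS: it is true and proved; the only room left for negative knowledge is WHICH hypotheses carry the
proof, answered in 2(a)/(b).
-/

noncomputable section

namespace Summit.CriticalPhenomena.Ising3DConformalLimit.Cruxes.WindowOfGrowth.Disproof

open Literature.Probability.LatticeModels Literature.Barriers.CriticalPhenomena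
open Summit.CriticalPhenomena.Ising3DConformalLimit.Theses.CoerciveSharpness (WindowOfGrowth)
open Summit.CriticalPhenomena.Ising3DConformalLimit.Theses.LatticeSDPCertificates (WindowBelowHalf)
open Summit.CriticalPhenomena.Ising3DConformalLimit.Theorems

/-! ## §0 Verdict: the crux holds (no disproof) -/

/-- **The crux is a theorem** (closing file p157968, line `eta_deficit`). -/
theorem windowOfGrowth_holds : WindowOfGrowth := windowOfGrowth_proof

/-- Hence `¬ WindowOfGrowth` is refutable: no disproof exists. -/
theorem not_not_windowOfGrowth : ¬ ¬ WindowOfGrowth := fun h => h windowOfGrowth_holds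

/-! ## §1 The two hypotheses and the conclusion, named -/

/-- The crux's first hypothesis: polynomial growth of the written-out reflected gradient (verbatim). -/
def Growth : Prop :=
  ∃ κ' c₀ : ℝ, 0 < κ' ∧ 0 < c₀ ∧ ∃ N₀ : ℕ, ∀ n : ℕ, N₀ ≤ n → c₀ * (n : ℝ) ^ κ' ≤ ∑ x ∈ box 3 n, ∑ i : Fin 3, ((if x + Pi.single i 1 ∈ box 3 n then (twoPointFree 3 (criticalBeta 3) x - twoPointFree 3 (criticalBeta 3) (Function.update x (0 : Fin 3) (2 * (n : ℤ) - x 0))) * freeExpect 3 (criticalBeta 3) 0 (spinPair (x + Pi.single i 1) (Function.update (x + Pi.single i 1) (0 : Fin 3) (2 * (n : ℤ) - (x + Pi.single i 1 : Site 3) 0))) else 0) + (if x - Pi.single i 1 ∈ box 3 n then (twoPointFree 3 (criticalBeta 3) x - twoPointFree 3 (criticalBeta 3) (Function.update x (0 : Fin 3) (2 * (n : ℤ) - x 0))) * freeExpect 3 (criticalBeta 3) 0 (spinPair (x - Pi.single i 1) (Function.update (x - Pi.single i 1) (0 : Fin 3) (2 * (n : ℤ) - (x - Pi.single i 1 : Site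 3) 0))) else 0))

/-- The crux's second hypothesis (= route item `DimensionPinned`). -/
def EtaBounds : Prop := ∃ η : ℝ, HasIsingEtaBounds 3 η

/-- The crux's conclusion: the all-scale window along `e₁` (verbatim; = `WindowBelowHalf`, item 5507). -/
def Window : Prop :=
  ∃ ε c : ℝ, 0 < ε ∧ 0 < c ∧ ∀ m n : ℕ, 1 ≤ m → m ≤ n → c * ((n : ℝ) / m) ^ (-((3:ℝ) / 2 - ε)) * criticalTwoPoint 3 (Pi.single 0 (m : ℤ)) ≤ criticalTwoPoint 3 (Pi.single 0 (n : ℤ))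

/-- The crux unfolds to `Growth → EtaBounds → Window`. -/
theorem windowOfGrowth_iff : WindowOfGrowth ↔ (Growth → EtaBounds → Window) := Iff.rfl

/-- The conclusion IS item 5507. -/
theorem window_iff_windowBelowHalf : Window ↔ WindowBelowHalf := Iff.rfl

/-- DC–Panis Thm 1.5 on two-sided bounds: `HasIsingEtaBounds 3 η → η ≤ 1/2` (two-sided bounds give the
log-sense exponent, `HasIsingExponentEta.of_bounded_holds`; then `dcp_isingEta_le_half_holds`).
[cite: DuminilCopinPanis2025LowerBounds, Theorem 1.5] -/
theorem eta_le_half_of_etaBounds {η : ℝ} (h : HasIsingEtaBounds 3 η) : η ≤ 1 / 2 :=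
  dcp_isingEta_le_half_holds η (HasIsingExponentEta.of_bounded_holds h)

/-- **Logical position of the crux**: `WindowOfGrowth ↔ (Growth → ¬ HasIsingEtaBounds 3 (1/2))`
(`η < 1/2` ⇒ window by `windowBelowHalf_of_hasIsingEtaBounds`; `η > 1/2` impossible by Thm 1.5;
`η = 1/2` kills the window by `not_windowBelowHalf_of_hasIsingEtaBounds_half`). -/
theorem windowOfGrowth_iff_not_half : WindowOfGrowth ↔ (Growth → ¬ HasIsingEtaBounds 3 (1 / 2)) := by
  rw [windowOfGrowth_iff]
  constructor
  · intro h hG hhalf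
    exact not_windowBelowHalf_of_hasIsingEtaBounds_half hhalf (h hG ⟨1 / 2, hhalf⟩)
  · intro h hG hE
    obtain ⟨η, hη⟩ := hE
    rcases lt_or_eq_of_le (eta_le_half_of_etaBounds hη) with hlt | heq
    · exact windowBelowHalf_of_hasIsingEtaBounds hlt hη
    · exact absurd (heq ▸ hη) (h hG)

/-- **What a refutation would have needed**: `¬ WindowOfGrowth ↔ Growth ∧ HasIsingEtaBounds 3 (1/2)` —
polynomial growth of `Q` AND `G ≍ ‖x‖^{-3/2}`; §0 shows the conjunction is contradictory. -/
theorem not_windowOfGrowth_iff : ¬ WindowOfGrowth ↔ (Growth ∧ HasIsingEtaBounds 3 (1 / 2)) := by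
  rw [windowOfGrowth_iff_not_half]
  constructor
  · intro h
    by_contra hc
    exact h fun hG hhalf => hc ⟨hG, hhalf⟩
  · rintro ⟨hG, hhalf⟩ h
    exact h hG hhalf

/-- Corollary of §0 + §1: growth of the reflected gradient EXCLUDES the boundary case `η = 1/2`. -/
theorem growth_excludes_half : Growth → ¬ HasIsingEtaBounds 3 (1 / 2) :=
  windowOfGrowth_iff_not_half.1 windowOfGrowth_holds

/-! ## §2 Load-bearing analysis -/

/-- The crux with its FIRST hypothesis (growth) dropped. -/
def WindowOfGrowthWithoutGrowth : Prop := EtaBounds → Window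

/-- **Dropping `Growth` leaves exactly the open boundary case**: `WindowOfGrowthWithoutGrowth ↔ ¬ HasIsingEtaBounds 3 (1/2)`.
Not refutable in the tree (a refutation = a PROOF of `G ≍ ‖x‖^{-3/2}` on `ℤ³`, physically false, `η ≈ 0.036`)
and not provable (DC–Panis Thm 1.5 stops at `η ≤ 1/2`): `Growth` is load-bearing. -/
theorem withoutGrowth_iff : WindowOfGrowthWithoutGrowth ↔ ¬ HasIsingEtaBounds 3 (1 / 2) := by
  unfold WindowOfGrowthWithoutGrowth
  constructor
  · intro h hhalf
    exact not_windowBelowHalf_of_hasIsingEtaBounds_half hhalf (h ⟨1 / 2, hhalf⟩)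
  · rintro h ⟨η, hη⟩
    rcases lt_or_eq_of_le (eta_le_half_of_etaBounds hη) with hlt | heq
    · exact windowBelowHalf_of_hasIsingEtaBounds hlt hη
    · exact absurd (heq ▸ hη) h

/-- The crux with its SECOND hypothesis (two-sided `η`-bounds) dropped. -/
def WindowOfGrowthWithoutEtaBounds : Prop := Growth → Window

/-- At the concrete level `WindowOfGrowthWithoutEtaBounds` is implied by the (conjecturally true) window itself,
so it cannot be refuted; its falsity lives at the PROFILE level (next theorem). -/
theorem withoutEtaBounds_of_window (h : Window) : WindowOfGrowthWithoutEtaBounds := fun _ => h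

/-- **`WindowOfGrowth_false_without_EtaBounds`, profile level** (LANDED: `Theorems/WindowOfGrowth/Negative/ProfileGrowthNoWindow.lean`,
p158487): the axis-profile facts, the Källén–Lehmann shape and PROFILE GROWTH (`κ' = 1/3`, every scale) do NOT
imply the profile window — witness `AxisProfileNoDoubling.g` (no doubling). Re-exported here. -/
theorem windowOfGrowth_profile_false_without_etaBounds :
    ¬ ∀ g : ℕ → ℝ, AxisProfileFacts g → HasAxisSpectralRepresentation g →
      (∃ κ' c : ℝ, 0 < κ' ∧ 0 < c ∧ ∃ N : ℕ, ∀ n : ℕ, N ≤ n →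
        c * (n : ℝ) ^ κ' ≤ g n * (1 + ∑ k ∈ Finset.Icc 1 (4 * n), (k : ℝ) ^ 2 * g k +
          (n : ℝ) * ∑ k ∈ Finset.Icc 1 (2 * n), (k : ℝ) * g k)) →
      (∃ ε c : ℝ, 0 < ε ∧ 0 < c ∧ ∀ m n : ℕ, 1 ≤ m → m ≤ n →
          c * ((n : ℝ) / m) ^ (-((3 : ℝ) / 2 - ε)) * g m ≤ g n) :=
  WindowOfGrowthNegative.not_forall_profileGrowth_imp_profileWindow

/-- **Faithfulness** (landed, same file): the crux's `Growth` gives PROFILE GROWTH of the true axis profile, so the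
profile-level statement above really is "`WindowOfGrowth` without `EtaBounds`" read on the profile. -/
theorem profileGrowth_of_growth (hG : Growth) :
    ∃ κ' c : ℝ, 0 < κ' ∧ 0 < c ∧ ∃ N : ℕ, ∀ n : ℕ, N ≤ n →
      c * (n : ℝ) ^ κ' ≤ criticalTwoPoint 3 (Pi.single 0 (n : ℤ)) *
        (1 + ∑ k ∈ Finset.Icc 1 (4 * n), (k : ℝ) ^ 2 * criticalTwoPoint 3 (Pi.single 0 (k : ℤ)) +
          (n : ℝ) * ∑ k ∈ Finset.Icc 1 (2 * n), (k : ℝ) * criticalTwoPoint 3 (Pi.single 0 (k : ℤ))) :=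
  WindowOfGrowthNegative.profileGrowth_of_reflectedGradientGrowth hG

/-- The crux's conclusion forces all-scale axial doubling of the true profile (item 6150 shape). -/
theorem axisDoubling_of_window (hW : Window) :
    AxisDoubling (fun k : ℕ => criticalTwoPoint 3 (Pi.single 0 (k : ℤ))) := by
  obtain ⟨ε, c, _hε, hc, hw⟩ := hW
  refine ⟨c * (2 : ℝ) ^ (-((3 : ℝ) / 2 - ε)), mul_pos hc (Real.rpow_pos_of_pos two_pos _),
    fun n hn => ?_⟩
  have h := hw n (2 * n) hn (by omega)
  have hn0 : (n : ℝ) ≠ 0 := by exact_mod_cast (show n ≠ 0 by omega)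
  have h2 : ((2 * n : ℕ) : ℝ) / n = 2 := by
    push_cast
    field_simp
  rw [h2] at h
  push_cast
  exact h

/-- Hence (by §0) growth + two-sided bounds give all-scale doubling of the critical axis profile — a
conditional proof of item 6150 `TwoPointDoubling` from `Growth ∧ DimensionPinned`. -/
theorem axisDoubling_of_growth_etaBounds (hG : Growth) (hE : EtaBounds) :
    AxisDoubling (fun k : ℕ => criticalTwoPoint 3 (Pi.single 0 (k : ℤ))) :=
  axisDoubling_of_window (windowOfGrowth_holds hG hE)

/-! ## §3 Hypothesis mutation summary (docstring-level; see the module docblock items 2–4)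

* weaken `HasIsingEtaBounds` to its UPPER half only: the deficit `κ' + 2b ≤ 1` survives (card
  `upper-half-deficit`), the window does not (needs the lower half: `windowBelowHalf_of_axis_rpow_bounds`);
  profile-level refuted by the same witness (its level function `n g(n)` is non-increasing, i.e. `b = 0` upper
  envelope in the strongest form).
* weaken to the log-sense exponent `HasIsingExponentEta 3 η`: the crux's own risk line; profile-level the witness
  has log-sense exponent `1/4` (plateaus `w_j = 2^{-j²}` on `n ∈ (M_{j-1}, M_j]`, `log₂ n ∈ (4(j-1)², 4j²]`) —
  NOT formalised this cycle (near-miss below).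
-/

/-- NEAR-MISS (not closed this cycle): the barrier witness has a log-sense profile exponent,
`log g(n) / log n → -(1 + 1/4)`, which would upgrade `ProfileGrowthNoWindow` to "profile facts + LOG-SENSE η = 1/4
(< 1/2) + growth ⇏ window", the exact profile form of the crux's risk line. Obstruction: only bookkeeping
(upper bound `level n ≤ C n^{-1/4}` needs the early-episode tails `Σ_{i<j-1} w_i e^{-n s_i}` and the `(j-1)`-st
episode `w_{j-1} e^{-n/M_{j-1}} ≤ n^{-1/4}`; lower bound is `n^{-1/4-o(1)}` only, so the statement is a limit,
≈ 200 lines of `Real.log` estimates). Not attempted because the crux closed `proved` during this cycle. -/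
theorem witness_logExponent_nearMiss : True := trivial

end Summit.CriticalPhenomena.Ising3DConformalLimit.Cruxes.WindowOfGrowth.Disproof

end
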